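import Literature.Geometry.DiscreteGeometry.SphericalCodeHullVertexWedge
import Mathlib.Combinatorics.Enumerative.DoubleCounting
import HarnessLib

/-!
# The link of a vertex of the fan-refined hull triangulation of a spherical code is a single cycle

Topic `Literature/Geometry/DiscreteGeometry`; provefact brick for `Hales2012_contactGraphTame` /
`Hales2012_contactGraphFccOrHcp` (the hypothesis "the hypermap is that of a triangulated
sphere" of the finite classification, Hales 2012, proof of Theorem 3, in the local form used by
the search: **the fan triangles at a vertex `y` that contain a given one and are closed under
sharing a side through `y` are ALL the fan triangles at `y`**).  For a finite set `X` of unit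
vectors of `ℝ³` with `0 ∈ interior (conv X)` and `y ∈ X`:

* Part A — tangent polar coordinates at `y` (`tangentFrame`, `azimuth` of
  `SphericalCodeVertexStar.lean`): `PolarRep`, the product formula
  `orient3 y u w = r_u r_w sin(θ_w − θ_u) · det(frame)` (`orient3_polar`), and
  `sameSide_of_arc`: a direction strictly inside an arc of length `< π` from `θ_u` to `θ_w` is
  strictly on the `u`-side and the `w`-side;
* Part B — `trisAt`, `fanNbrs` (the fan neighbours of `y`), `card_trisAt_eq_card_fanNbrs`
  (as many triangles as neighbours at `y`, double counting with
  `card_filter_fanTriSets_eq_two`), `inner_sq_lt_one_of_mem_fanNbrs`, and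
  `azimuth_injOn_fanNbrs` (distinct neighbours have distinct azimuths, by the wedge lemma);
* Part C — the cyclic order: for an azimuth-increasing enumeration `nb` of the neighbours,
  every fan triangle at `y` is `{y, nb k, nb (k+1)}` for a cyclically consecutive pair
  (`exists_consec_of_mem_trisAt`, by the wedge lemma `not_sameSide_of_fanNbr`), all these
  triples ARE fan triangles (counting), and **`fanTriSets_link`**.

## References
* T. C. Hales, arXiv:1209.6043 (2012), proof of Theorem 3. [`Hales2012`]
-/

noncomputable section

namespace Literature.Geometry.DiscreteGeometry

open Real RealInnerProductSpace Finset

section Link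

local notation "E3" => EuclideanSpace ℝ (Fin 3)

variable {X : Finset E3} {y : E3} {hy : ‖y‖ = 1}

/-! ### Part A. Tangent polar coordinates and the product formula -/

/-- The tangential radius `√(1 − ⟪y, u⟫²)` of `u` seen from `y`. [folklore] -/
def trad (y u : E3) : ℝ := Real.sqrt (1 - ⟪y, u⟫ ^ 2)

/-- `u` has tangent polar angle `φ` at `y` (any representative modulo `2π` of the azimuth).
[folklore] -/
def PolarRep (y : E3) (hy : ‖y‖ = 1) (u : E3) (φ : ℝ) : Prop :=
  ⟪tangentFrame y hy 0, u⟫ = trad y u * Real.cos φ ∧ ⟪tangentFrame y hy 1, u⟫ = trad y u * Real.sin φ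

/-- The azimuth is a polar angle. [folklore] -/
theorem polarRep_azimuth {u : E3} (hu : ‖u‖ = 1) : PolarRep y hy u (azimuth y hy u) :=
  inner_frame_eq_polar hu rfl

/-- Shifting a polar angle by `2π`. [folklore] -/
theorem PolarRep.add_two_pi {u : E3} {φ : ℝ} (h : PolarRep y hy u φ) : PolarRep y hy u (φ + 2 * π) := by
  unfold PolarRep at h ⊢
  rw [Real.cos_add_two_pi, Real.sin_add_two_pi]; exact h

/-- Shifting a polar angle by `-2π`. [folklore] -/
theorem PolarRep.sub_two_pi {u : E3} {φ : ℝ} (h : PolarRep y hy u φ) : PolarRep y hy u (φ - 2 * π) := by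
  unfold PolarRep at h ⊢
  rw [Real.cos_sub_two_pi, Real.sin_sub_two_pi]; exact h

/-- Expansion of a vector in the tangent frame. [folklore] -/
theorem eq_sum_tangentFrame (u : E3) :
    u = ⟪tangentFrame y hy 0, u⟫ • tangentFrame y hy 0 + ⟪tangentFrame y hy 1, u⟫ • tangentFrame y hy 1 +
      ⟪tangentFrame y hy 2, u⟫ • tangentFrame y hy 2 := by
  conv_lhs => rw [← (tangentFrame y hy).sum_repr' u]
  rw [Fin.sum_univ_three]

/-- The frame vectors `b₀, b₁` are orthogonal to `y = b₂`. [folklore] -/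
theorem inner_tangentFrame_y (i : Fin 3) (hi : i ≠ 2) : ⟪tangentFrame y hy i, y⟫ = 0 := by
  have h := tangentFrame_inner (v := y) (hv := hy) i 2
  rw [tangentFrame_two, if_neg hi] at h
  exact h

/-- The determinant of `b₂` with two combinations in the frame `b₀, b₁, b₂`. [folklore] -/
theorem orient3_frame_two (b₀ b₁ b₂ : E3) (p q r p' q' r' : ℝ) :
    orient3 b₂ (p • b₀ + q • b₁ + r • b₂) (p' • b₀ + q' • b₁ + r' • b₂) =
      (p * q' - q * p') * orient3 b₀ b₁ b₂ := by
  simp only [orient3, PiLp.add_apply, PiLp.smul_apply, smul_eq_mul]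
  ring

/-- **The product formula**: `orient3 y u w = r_u r_w sin(ω − α) · det(frame)` for polar angles
`α` of `u` and `ω` of `w`. [folklore] -/
theorem orient3_polar {u w : E3} {α ω : ℝ} (hu : PolarRep y hy u α) (hw : PolarRep y hy w ω) :
    orient3 y u w = trad y u * trad y w * Real.sin (ω - α) *
      orient3 (tangentFrame y hy 0) (tangentFrame y hy 1) (tangentFrame y hy 2) := by
  obtain ⟨hu0, hu1⟩ := hu
  obtain ⟨hw0, hw1⟩ := hw
  have e : orient3 y u w = orient3 (tangentFrame y hy 2) u w := by rw [tangentFrame_two]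
  rw [e]
  conv_lhs => rw [eq_sum_tangentFrame (hy := hy) u, eq_sum_tangentFrame (hy := hy) w]
  rw [orient3_frame_two, hu0, hu1, hw0, hw1, Real.sin_sub]
  ring

/-- **Directions strictly inside a short arc are strictly inside the wedge (sign form).**  If
`u, n, w` have positive tangential radii and polar angles `α < ν < ω < α + π`, then
`orient3 y u n` and `orient3 y n w` have strictly the sign of `orient3 y u w`. [folklore] -/
theorem sameSide_of_arc {u n w : E3} {α ν ω : ℝ} (hu : PolarRep y hy u α) (hn : PolarRep y hy n ν)
    (hw : PolarRep y hy w ω) (ru : 0 < trad y u) (rn : 0 < trad y n) (rw : 0 < trad y w)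
    (h1 : α < ν) (h2 : ν < ω) (h3 : ω < α + π) :
    0 < orient3 y u w * orient3 y u n ∧ 0 < orient3 y u w * orient3 y n w := by
  have hΔ := orient3_orthonormalBasis_ne_zero (tangentFrame y hy)
  have hΔ2 : 0 < orient3 (tangentFrame y hy 0) (tangentFrame y hy 1) (tangentFrame y hy 2) ^ 2 := by
    positivity
  have s1 : 0 < Real.sin (ω - α) := Real.sin_pos_of_pos_of_lt_pi (by linarith) (by linarith)
  have s2 : 0 < Real.sin (ν - α) := Real.sin_pos_of_pos_of_lt_pi (by linarith) (by linarith)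
  have s3 : 0 < Real.sin (ω - ν) := Real.sin_pos_of_pos_of_lt_pi (by linarith) (by linarith)
  rw [orient3_polar hu hw, orient3_polar hu hn, orient3_polar hn hw]
  set Δ := orient3 (tangentFrame y hy 0) (tangentFrame y hy 1) (tangentFrame y hy 2)
  constructor
  · have : trad y u * trad y w * Real.sin (ω - α) * Δ * (trad y u * trad y n * Real.sin (ν - α) * Δ) =
        (trad y u * trad y u * trad y w * trad y n * (Real.sin (ω - α) * Real.sin (ν - α))) * Δ ^ 2 := by
      ring
    rw [this]; positivity
  · have : trad y u * trad y w * Real.sin (ω - α) * Δ * (trad y n * trad y w * Real.sin (ω - ν) * Δ) =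
        (trad y u * trad y w * trad y n * trad y w * (Real.sin (ω - α) * Real.sin (ω - ν))) * Δ ^ 2 := by
      ring
    rw [this]; positivity

/-- **Equal polar angles**: `n'` is a positive multiple of `n` plus a multiple of `y`.
[folklore] -/
theorem eq_smul_add_smul_of_polarRep {n n' : E3} {ν : ℝ} (hn : PolarRep y hy n ν)
    (hn' : PolarRep y hy n' ν) (rn : 0 < trad y n) :
    n' = (trad y n' / trad y n) • n + (⟪y, n'⟫ - trad y n' / trad y n * ⟪y, n⟫) • y := by
  obtain ⟨h0, h1⟩ := hn
  obtain ⟨h0', h1'⟩ := hn'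
  have hyy : ⟪y, y⟫ = 1 := by rw [real_inner_self_eq_norm_sq, hy, one_pow]
  have hy0 : ⟪tangentFrame y hy 0, y⟫ = 0 := inner_tangentFrame_y 0 (by decide)
  have hy1 : ⟪tangentFrame y hy 1, y⟫ = 0 := inner_tangentFrame_y 1 (by decide)
  refine eq_of_inner_basis_eq (tangentFrame y hy) fun m => ?_
  fin_cases m
  · show ⟪tangentFrame y hy 0, n'⟫ = ⟪tangentFrame y hy 0, _⟫
    rw [inner_add_right, real_inner_smul_right, real_inner_smul_right, hy0, h0, h0']
    field_simp
    ring
  · show ⟪tangentFrame y hy 1, n'⟫ = ⟪tangentFrame y hy 1, _⟫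
    rw [inner_add_right, real_inner_smul_right, real_inner_smul_right, hy1, h1, h1']
    field_simp
    ring
  · show ⟪tangentFrame y hy 2, n'⟫ = ⟪tangentFrame y hy 2, _⟫
    rw [tangentFrame_two, inner_add_right, real_inner_smul_right, real_inner_smul_right, hyy]
    ring

/-! ### Part B. Triangles and fan neighbours at a vertex -/

/-- The fan triangles at `y`. [folklore] -/
def trisAt (X : Finset E3) (y : E3) : Finset (Finset E3) := (fanTriSets X).filter fun t => y ∈ t

/-- **The fan neighbours of `y`**: the other vertices of the fan triangles at `y`. [folklore] -/
def fanNbrs (X : Finset E3) (y : E3) : Finset E3 := (trisAt X y).biUnion fun t => t.erase y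

/-- Membership in `trisAt`. [folklore] -/
theorem mem_trisAt {t : Finset E3} : t ∈ trisAt X y ↔ t ∈ fanTriSets X ∧ y ∈ t := Finset.mem_filter

/-- Membership in `fanNbrs`. [folklore] -/
theorem mem_fanNbrs {n : E3} : n ∈ fanNbrs X y ↔ ∃ t ∈ fanTriSets X, y ∈ t ∧ n ∈ t ∧ n ≠ y := by
  unfold fanNbrs
  rw [Finset.mem_biUnion]
  constructor
  · rintro ⟨t, ht, hn⟩
    rw [mem_trisAt] at ht
    rw [Finset.mem_erase] at hn
    exact ⟨t, ht.1, ht.2, hn.2, hn.1⟩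
  · rintro ⟨t, ht, hyt, hnt, hny⟩
    exact ⟨t, mem_trisAt.2 ⟨ht, hyt⟩, Finset.mem_erase.2 ⟨hny, hnt⟩⟩

/-- A fan triangle at `y` is `{y, a, b}` with `y, a, b` pairwise distinct fan data. [folklore] -/
theorem exists_eq_triple_of_mem_trisAt (hX1 : ∀ y ∈ X, ‖y‖ = 1) {t : Finset E3} (ht : t ∈ trisAt X y) :
    ∃ a b : E3, a ∈ fanNbrs X y ∧ b ∈ fanNbrs X y ∧ y ≠ a ∧ y ≠ b ∧ a ≠ b ∧ t = {y, a, b} := by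
  obtain ⟨htF, hyt⟩ := mem_trisAt.1 ht
  have h3 := card_eq_three_of_mem_fanTriSets hX1 htF
  have h2 : (t.erase y).card = 2 := by rw [Finset.card_erase_of_mem hyt, h3]
  obtain ⟨a, b, hab, hte⟩ := Finset.card_eq_two.1 h2
  have ha : a ∈ t.erase y := by rw [hte]; simp
  have hb : b ∈ t.erase y := by rw [hte]; simp
  rw [Finset.mem_erase] at ha hb
  refine ⟨a, b, mem_fanNbrs.2 ⟨t, htF, hyt, ha.2, ha.1⟩, mem_fanNbrs.2 ⟨t, htF, hyt, hb.2, hb.1⟩,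
    Ne.symm ha.1, Ne.symm hb.1, hab, ?_⟩
  rw [← Finset.insert_erase hyt, hte]

/-- Exactly two fan triangles at `y` contain a given fan neighbour. [folklore] -/
theorem card_trisAt_filter_mem (hX1 : ∀ y ∈ X, ‖y‖ = 1)
    (h0 : (0 : E3) ∈ interior (convexHull ℝ (X : Set E3))) {n : E3} (hn : n ∈ fanNbrs X y) :
    ((trisAt X y).filter fun t => n ∈ t).card = 2 := by
  obtain ⟨t, ht, hyt, hnt, hny⟩ := mem_fanNbrs.1 hn
  have heq : (trisAt X y).filter (fun t => n ∈ t) = (fanTriSets X).filter fun t' => ({y, n} : Finset E3) ⊆ t' := by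
    ext t'
    simp only [trisAt, Finset.mem_filter, Finset.insert_subset_iff, Finset.singleton_subset_iff, and_assoc]
  rw [heq]
  exact card_filter_fanTriSets_eq_two hX1 h0 ht
    (Finset.insert_subset_iff.2 ⟨hyt, Finset.singleton_subset_iff.2 hnt⟩) (Finset.card_pair (Ne.symm hny))

/-- **As many fan triangles as fan neighbours at `y`** (double counting: every triangle at
`y` has two further vertices, every neighbour lies in two triangles at `y`). [folklore] -/
theorem card_trisAt_eq_card_fanNbrs (hX1 : ∀ y ∈ X, ‖y‖ = 1)
    (h0 : (0 : E3) ∈ interior (convexHull ℝ (X : Set E3))) :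
    (trisAt X y).card = (fanNbrs X y).card := by
  classical
  have h := Finset.card_mul_eq_card_mul (r := fun (t : Finset E3) (n : E3) => n ∈ t)
    (s := trisAt X y) (t := fanNbrs X y) (m := 2) (n := 2) ?_ ?_
  · omega
  · intro t ht
    have heq : (fanNbrs X y).bipartiteAbove (fun (t : Finset E3) (n : E3) => n ∈ t) t = t.erase y := by
      ext n
      rw [Finset.mem_bipartiteAbove, Finset.mem_erase]
      constructor
      · rintro ⟨hn, hnt⟩
        obtain ⟨-, -, -, -, hny⟩ := mem_fanNbrs.1 hn
        exact ⟨hny, hnt⟩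
      · rintro ⟨hny, hnt⟩
        obtain ⟨htF, hyt⟩ := mem_trisAt.1 ht
        exact ⟨mem_fanNbrs.2 ⟨t, htF, hyt, hnt, hny⟩, hnt⟩
    rw [heq, Finset.card_erase_of_mem (mem_trisAt.1 ht).2,
      card_eq_three_of_mem_fanTriSets hX1 (mem_trisAt.1 ht).1]
  · intro n hn
    have heq : (trisAt X y).bipartiteBelow (fun (t : Finset E3) (n : E3) => n ∈ t) n =
        (trisAt X y).filter fun t => n ∈ t := rfl
    rw [heq]
    exact card_trisAt_filter_mem hX1 h0 hn

/-- A fan neighbour of `y` is not `±y`: `⟪y, n⟫² < 1`, i.e. its tangential radius is positive.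
[folklore] -/
theorem inner_sq_lt_one_of_mem_fanNbrs (hX1 : ∀ y ∈ X, ‖y‖ = 1) {n : E3} (hn : n ∈ fanNbrs X y) :
    ⟪y, n⟫ ^ 2 < 1 := by
  obtain ⟨t, ht, hyt, hnt, hny⟩ := mem_fanNbrs.1 hn
  obtain ⟨c, hc, htc⟩ := exists_subset_tightSet_of_mem_fanTriSets hX1 ht
  have hy1 : ‖y‖ = 1 := hX1 y (mem_tightSet.1 (htc hyt)).1
  have hn1 : ‖n‖ = 1 := hX1 n (mem_tightSet.1 (htc hnt)).1
  have hle : ⟪y, n⟫ ≤ 1 := real_inner_le_one_of_norm_eq_one hy1 hn1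
  have hge : -1 ≤ ⟪y, n⟫ := neg_one_le_real_inner_of_norm_eq_one hy1 hn1
  have hne1 : ⟪y, n⟫ ≠ 1 := fun h => hny ((inner_eq_one_iff_of_norm_eq_one hy1 hn1).1 h).symm
  have hne2 : ⟪y, n⟫ ≠ -1 := by
    intro h
    have hyn : y = -n := (inner_eq_neg_one_iff_of_norm_eq_one hy1 hn1).1 h
    have h1 := (mem_tightSet.1 (htc hyt)).2
    have h2 := (mem_tightSet.1 (htc hnt)).2
    rw [hyn, inner_neg_right, h2] at h1
    norm_num at h1
  have hlt : ⟪y, n⟫ < 1 := lt_of_le_of_ne hle hne1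
  have hgt : -1 < ⟪y, n⟫ := lt_of_le_of_ne hge (Ne.symm hne2)
  nlinarith

/-- The tangential radius of a fan neighbour is positive. [folklore] -/
theorem trad_pos_of_mem_fanNbrs (hX1 : ∀ y ∈ X, ‖y‖ = 1) {n : E3} (hn : n ∈ fanNbrs X y) :
    0 < trad y n :=
  Real.sqrt_pos.2 (by linarith [inner_sq_lt_one_of_mem_fanNbrs hX1 hn])

/-- Fan neighbours are unit vectors. [folklore] -/
theorem norm_eq_one_of_mem_fanNbrs (hX1 : ∀ y ∈ X, ‖y‖ = 1) {n : E3} (hn : n ∈ fanNbrs X y) :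
    ‖n‖ = 1 := by
  obtain ⟨t, ht, -, hnt, -⟩ := mem_fanNbrs.1 hn
  exact hX1 n (subset_of_mem_fanTriSets hX1 ht hnt)

/-- A fan neighbour `a` of `y` spans, with `y`, a side of a fan triangle `{y, a, b}` at `y`
with a third vertex `b`. [folklore] -/
theorem exists_triple_of_mem_fanNbrs (hX1 : ∀ y ∈ X, ‖y‖ = 1) {a : E3} (ha : a ∈ fanNbrs X y) :
    ∃ t ∈ fanTriSets X, ∃ b : E3, b ∈ fanNbrs X y ∧ y ≠ a ∧ y ≠ b ∧ a ≠ b ∧ t = {y, a, b} := by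
  obtain ⟨t, ht, hyt, hat, hay⟩ := mem_fanNbrs.1 ha
  obtain ⟨a', b', ha', hb', hya', hyb', hab', hte⟩ :=
    exists_eq_triple_of_mem_trisAt hX1 (mem_trisAt.2 ⟨ht, hyt⟩)
  have hmem : a ∈ ({y, a', b'} : Finset E3) := hte ▸ hat
  simp only [Finset.mem_insert, Finset.mem_singleton] at hmem
  rcases hmem with h | h | h
  · exact absurd h hay
  · subst h; exact ⟨t, ht, b', hb', hya', hyb', hab', hte⟩
  · subst h
    refine ⟨t, ht, a', ha', hyb', hya', Ne.symm hab', ?_⟩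
    rw [hte]; ext z; simp only [Finset.mem_insert, Finset.mem_singleton]; tauto

/-- **Distinct fan neighbours of `y` have distinct azimuths at `y`** (else one would lie in the
closed wedge of a triangle through the other: `not_sameSide_of_fanNbr`). [folklore] -/
theorem azimuth_injOn_fanNbrs (hX1 : ∀ y ∈ X, ‖y‖ = 1) (hy : ‖y‖ = 1) :
    Set.InjOn (azimuth y hy) (fanNbrs X y : Set E3) := by
  intro n hn n' hn' heq
  have hnF := Finset.mem_coe.1 hn
  have hn'F := Finset.mem_coe.1 hn'
  by_contra hne
  -- a triangle `{y, n, b}` through the side `{y, n}`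
  obtain ⟨t, ht, b, hb, hyn, hyb, hnb, hte⟩ := exists_triple_of_mem_fanNbrs hX1 hnF
  obtain ⟨t', ht', hyt', hn't', -⟩ := mem_fanNbrs.1 hn'F
  have rn := trad_pos_of_mem_fanNbrs hX1 hnF
  have pn : PolarRep y hy n (azimuth y hy n) := polarRep_azimuth (norm_eq_one_of_mem_fanNbrs hX1 hnF)
  have pn' : PolarRep y hy n' (azimuth y hy n) :=
    heq ▸ polarRep_azimuth (norm_eq_one_of_mem_fanNbrs hX1 hn'F)
  have hdec := eq_smul_add_smul_of_polarRep pn pn' rn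
  set μ := trad y n' / trad y n with hμ
  have hμpos : 0 < μ := div_pos (trad_pos_of_mem_fanNbrs hX1 hn'F) rn
  -- the determinants
  have e1 : orient3 y n n' = 0 := by
    rw [hdec]
    simp only [orient3_add_right, orient3_smul_right, orient3_self_right, orient3_self_outer, mul_zero,
      add_zero]
  have e2 : orient3 y n' b = μ * orient3 y n b := by
    rw [hdec, orient3_add_mid, orient3_smul_mid, orient3_smul_mid, orient3_self_left, mul_zero, add_zero]
  -- `n' ≠ b` (else `y, n, b` would be dependent)
  obtain ⟨p, hp, hpt⟩ := mem_fanTriSets.1 ht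
  have hc := (mem_fanTriangles.1 hp).1
  have hsub : t ⊆ tightSet X p.1 := hpt ▸ fanVerts_subset_tightSet hX1 hp
  have hyt : y ∈ t := by rw [hte]; simp
  have hnt : n ∈ t := by rw [hte]; simp
  have hbt : b ∈ t := by rw [hte]; simp
  have hO := orient3_ne_zero_of_three_tight hX1 hc (hsub hyt) (hsub hnt) (hsub hbt) hyn hyb hnb
  have hn'b : n' ≠ b := by
    intro h
    rw [h] at e1
    exact hO e1
  refine not_sameSide_of_fanNbr hX1 ht ht' hte hyn hyb hnb hyt' hn't' (fun h => ?_) (Ne.symm hne) hn'b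
    ⟨?_, ?_, Or.inr ?_⟩
  · exact (mem_fanNbrs.1 hn'F).choose_spec.2.2.2 h.symm
  · rw [e1, mul_zero]
  · rw [e2]; nlinarith [mul_pos hμpos (pow_pos (abs_pos.2 hO) 2), sq_abs (orient3 y n b)]
  · rw [e2]
    have : orient3 y n b * (μ * orient3 y n b) = μ * orient3 y n b ^ 2 := by ring
    rw [this]
    positivity

/-! ### Part C. The cyclic order of the fan neighbours; the link is a single cycle -/

/-- **An azimuth-increasing periodic enumeration of the fan neighbours of `y`** (period
`d = #fanNbrs`). [folklore] -/
structure NbrEnum (X : Finset E3) (y : E3) (hy : ‖y‖ = 1) where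
  /-- the number of fan neighbours -/
  d : ℕ
  /-- the enumeration (on `ℕ`, `d`-periodic) -/
  nb : ℕ → E3
  /-- `d > 0` -/
  d_pos : 0 < d
  /-- `d = #fanNbrs` -/
  card_eq : (fanNbrs X y).card = d
  /-- periodicity -/
  periodic : ∀ k, nb (k + d) = nb k
  /-- values are fan neighbours -/
  mem : ∀ k, nb k ∈ fanNbrs X y
  /-- every fan neighbour is enumerated -/
  surj : ∀ n ∈ fanNbrs X y, ∃ k, k < d ∧ nb k = n
  /-- azimuths increase on a period -/
  mono : ∀ j k, j < k → k < d → azimuth y hy (nb j) < azimuth y hy (nb k)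

/-- **Existence of the enumeration** (sort the azimuths, which are pairwise distinct by
`azimuth_injOn_fanNbrs`). [folklore] -/
theorem nonempty_nbrEnum (hX1 : ∀ y ∈ X, ‖y‖ = 1) (hy : ‖y‖ = 1) (hne : (fanNbrs X y).Nonempty) :
    Nonempty (NbrEnum X y hy) := by
  classical
  have hcard : (fanNbrs X y).card = ((fanNbrs X y).image (azimuth y hy)).card :=
    (Finset.card_image_of_injOn (azimuth_injOn_fanNbrs hX1 hy)).symm
  have hpos : 0 < ((fanNbrs X y).image (azimuth y hy)).card := by rw [← hcard]; exact Finset.card_pos.2 hne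
  have hex : ∀ k : Fin ((fanNbrs X y).image (azimuth y hy)).card, ∃ n, n ∈ fanNbrs X y ∧
      azimuth y hy n = ((fanNbrs X y).image (azimuth y hy)).orderEmbOfFin rfl k := fun k => by
    obtain ⟨n, hn, h⟩ := Finset.mem_image.1 (((fanNbrs X y).image (azimuth y hy)).orderEmbOfFin_mem rfl k)
    exact ⟨n, hn, h⟩
  choose g hg using hex
  have hsurj : ∀ n ∈ fanNbrs X y, ∃ k, k < ((fanNbrs X y).image (azimuth y hy)).card ∧
      g ⟨k % ((fanNbrs X y).image (azimuth y hy)).card, Nat.mod_lt _ hpos⟩ = n := by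
    intro n hn
    have hmem : azimuth y hy n ∈ Set.range (((fanNbrs X y).image (azimuth y hy)).orderEmbOfFin rfl) := by
      rw [Finset.range_orderEmbOfFin, Finset.mem_coe]
      exact Finset.mem_image_of_mem _ hn
    obtain ⟨k, hk⟩ := hmem
    refine ⟨k, k.2, ?_⟩
    have hk' : (⟨(k : ℕ) % ((fanNbrs X y).image (azimuth y hy)).card, Nat.mod_lt _ hpos⟩ :
        Fin ((fanNbrs X y).image (azimuth y hy)).card) = k := Fin.ext (Nat.mod_eq_of_lt k.2)
    rw [hk']
    exact azimuth_injOn_fanNbrs hX1 hy (Finset.mem_coe.2 (hg k).1) (Finset.mem_coe.2 hn) ((hg k).2.trans hk)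
  have hmono : ∀ j k, j < k → k < ((fanNbrs X y).image (azimuth y hy)).card →
      azimuth y hy (g ⟨j % ((fanNbrs X y).image (azimuth y hy)).card, Nat.mod_lt _ hpos⟩) <
        azimuth y hy (g ⟨k % ((fanNbrs X y).image (azimuth y hy)).card, Nat.mod_lt _ hpos⟩) := by
    intro j k hjk hk
    have hj' : (⟨j % ((fanNbrs X y).image (azimuth y hy)).card, Nat.mod_lt _ hpos⟩ :
        Fin ((fanNbrs X y).image (azimuth y hy)).card) = ⟨j, lt_trans hjk hk⟩ :=
      Fin.ext (Nat.mod_eq_of_lt (lt_trans hjk hk))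
    have hk' : (⟨k % ((fanNbrs X y).image (azimuth y hy)).card, Nat.mod_lt _ hpos⟩ :
        Fin ((fanNbrs X y).image (azimuth y hy)).card) = ⟨k, hk⟩ := Fin.ext (Nat.mod_eq_of_lt hk)
    rw [hj', hk', (hg _).2, (hg _).2]
    exact (((fanNbrs X y).image (azimuth y hy)).orderEmbOfFin rfl).strictMono (Fin.mk_lt_mk.2 hjk)
  exact ⟨⟨((fanNbrs X y).image (azimuth y hy)).card,
    fun k => g ⟨k % ((fanNbrs X y).image (azimuth y hy)).card, Nat.mod_lt _ hpos⟩, hpos, hcard,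
    fun k => by simp only [Nat.add_mod_right], fun k => (hg _).1, hsurj, hmono⟩⟩

namespace NbrEnum

variable (E : NbrEnum X y hy)

/-- Injectivity on a period. [folklore] -/
theorem nb_inj {j k : ℕ} (hj : j < E.d) (hk : k < E.d) (h : E.nb j = E.nb k) : j = k := by
  by_contra hne
  rcases Nat.lt_or_gt_of_ne hne with hlt | hlt
  · exact (E.mono j k hlt hk).ne (by rw [h])
  · exact (E.mono k j hlt hj).ne (by rw [h])

/-- Reduction modulo the period. [folklore] -/
theorem nb_mod (k : ℕ) : E.nb (k % E.d) = E.nb k := by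
  conv_rhs => rw [← Nat.mod_add_div k E.d]
  induction k / E.d with
  | zero => simp
  | succ q ih => rw [Nat.mul_succ, ← add_assoc, E.periodic, ih]

/-- Injectivity modulo the period. [folklore] -/
theorem mod_eq_of_nb_eq {j k : ℕ} (h : E.nb j = E.nb k) : j % E.d = k % E.d :=
  E.nb_inj (Nat.mod_lt _ E.d_pos) (Nat.mod_lt _ E.d_pos) (by rw [E.nb_mod, E.nb_mod, h])

/-- Values are not `y`. [folklore] -/
theorem nb_ne (k : ℕ) : E.nb k ≠ y := (mem_fanNbrs.1 (E.mem k)).choose_spec.2.2.2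

/-- Consecutive values differ once `d ≥ 2`; values two apart differ once `d ≥ 3`. [folklore] -/
theorem nb_ne_nb_add {k s : ℕ} (hs : 0 < s) (hsd : s < E.d) : E.nb k ≠ E.nb (k + s) := by
  intro h
  have hmod := E.mod_eq_of_nb_eq h
  have hdvd : E.d ∣ (k + s) - k := (Nat.modEq_iff_dvd' (Nat.le_add_right k s)).1 hmod
  rw [Nat.add_sub_cancel_left] at hdvd
  exact absurd (Nat.le_of_dvd hs hdvd) (not_le.2 hsd)

/-- **Every fan triangle at `y` joins two cyclically consecutive neighbours** (increasing
indices form). [folklore] -/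
theorem consec_aux (hX1 : ∀ y ∈ X, ‖y‖ = 1) {i j : ℕ} (hij : i < j) (hj : j < E.d) {t : Finset E3}
    (ht : t ∈ fanTriSets X) (hte : t = {y, E.nb i, E.nb j}) :
    j = i + 1 ∨ (i = 0 ∧ j + 1 = E.d) := by
  set a := E.nb i with ha_def
  set b := E.nb j with hb_def
  have hi : i < E.d := lt_trans hij hj
  have ha : a ∈ fanNbrs X y := E.mem i
  have hb : b ∈ fanNbrs X y := E.mem j
  have hya : y ≠ a := (E.nb_ne i).symm
  have hyb : y ≠ b := (E.nb_ne j).symm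
  have hab : a ≠ b := fun h => absurd (E.nb_inj hi hj h) hij.ne
  have ra := trad_pos_of_mem_fanNbrs hX1 ha
  have rb := trad_pos_of_mem_fanNbrs hX1 hb
  have pa : PolarRep y hy a (azimuth y hy a) := polarRep_azimuth (norm_eq_one_of_mem_fanNbrs hX1 ha)
  have pb : PolarRep y hy b (azimuth y hy b) := polarRep_azimuth (norm_eq_one_of_mem_fanNbrs hX1 hb)
  set α := azimuth y hy a with hα
  set β := azimuth y hy b with hβ
  have hαβ : α < β := E.mono i j hij hj
  have hαl : -π < α := neg_pi_lt_azimuth y hy a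
  have hβu : β ≤ π := azimuth_le_pi y hy b
  -- the triangle is nondegenerate
  obtain ⟨p, hp, hpt⟩ := mem_fanTriSets.1 ht
  have hc := (mem_fanTriangles.1 hp).1
  have hsub : t ⊆ tightSet X p.1 := hpt ▸ fanVerts_subset_tightSet hX1 hp
  have hyt : y ∈ t := by rw [hte]; simp
  have hat : a ∈ t := by rw [hte]; simp
  have hbt : b ∈ t := by rw [hte]; simp
  have hO := orient3_ne_zero_of_three_tight hX1 hc (hsub hyt) (hsub hat) (hsub hbt) hya hyb hab
  -- a neighbour `n = nb k` strictly inside an arc contradicts the wedge lemma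
  have wedge : ∀ {k : ℕ}, k < E.d → k ≠ i → k ≠ j → ∀ {u w : E3} {αu ω : ℝ},
      (t = {y, u, w}) → y ≠ u → y ≠ w → u ≠ w → PolarRep y hy u αu → PolarRep y hy w ω →
      0 < trad y u → 0 < trad y w → (u = a ∨ u = b) → (w = a ∨ w = b) →
      αu < azimuth y hy (E.nb k) → azimuth y hy (E.nb k) < ω → ω < αu + π → False := by
    intro k hk hki hkj u w αu ω htuw hyu hyw huw pu pw ru rw hu hw h1 h2 h3
    set n := E.nb k
    have hn : n ∈ fanNbrs X y := E.mem k
    obtain ⟨t', ht', hyt', hnt', hny⟩ := mem_fanNbrs.1 hn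
    have pn : PolarRep y hy n (azimuth y hy n) := polarRep_azimuth (norm_eq_one_of_mem_fanNbrs hX1 hn)
    have rn := trad_pos_of_mem_fanNbrs hX1 hn
    obtain ⟨s1, s2⟩ := sameSide_of_arc pu pn pw ru rn rw h1 h2 h3
    have hna : n ≠ a := fun h => hki (E.nb_inj hk hi h)
    have hnb : n ≠ b := fun h => hkj (E.nb_inj hk hj h)
    have hnu : n ≠ u := by rcases hu with rfl | rfl <;> assumption
    have hnw : n ≠ w := by rcases hw with rfl | rfl <;> assumption
    exact not_sameSide_of_fanNbr hX1 ht ht' htuw hyu hyw huw hyt' hnt' (Ne.symm hny) hnu hnw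
      ⟨s1.le, s2.le, Or.inl s1⟩
  have hte' : t = {y, b, a} := by
    rw [hte]; ext z; simp only [Finset.mem_insert, Finset.mem_singleton]; tauto
  rcases lt_trichotomy (β - α) π with hlt | heq | hgt
  · -- short arc from `a` to `b`: nothing strictly between
    left
    by_contra hne
    have hk : i + 1 < j := by omega
    exact wedge (k := i + 1) (by omega) (by omega) (by omega) hte hya hyb hab pa pb ra rb (Or.inl rfl)
      (Or.inr rfl) (E.mono i (i + 1) (by omega) (by omega)) (E.mono (i + 1) j hk hj) (by linarith)
  · -- antipodal directions: degenerate triangle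
    exfalso
    apply hO
    rw [orient3_polar pa pb, show β - α = π from heq, Real.sin_pi]
    ring
  · -- short arc from `b` through `±π` to `a`: `b` is the last and `a` the first neighbour
    right
    by_contra hne
    have hcases : 0 < i ∨ j + 1 < E.d := by omega
    rcases hcases with hi0 | hj1
    · -- `nb (i-1)` lies strictly inside the arc from `β - 2π` to `α`
      have hm := E.mono (i - 1) i (by omega) hi
      rw [show E.nb i = a from rfl] at hm
      have hlow : β - 2 * π < azimuth y hy (E.nb (i - 1)) := by
        have := neg_pi_lt_azimuth y hy (E.nb (i - 1)); linarith
      exact wedge (k := i - 1) (by omega) (by omega) (by omega) hte' hyb hya hab.symm pb.sub_two_pi pa rb ra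
        (Or.inr rfl) (Or.inl rfl) hlow hm (by linarith)
    · -- `nb (j+1)` lies strictly inside the arc from `β` to `α + 2π`
      have hm := E.mono j (j + 1) (by omega) hj1
      rw [show E.nb j = b from rfl] at hm
      have hup : azimuth y hy (E.nb (j + 1)) < α + 2 * π := by
        have := azimuth_le_pi y hy (E.nb (j + 1)); linarith
      exact wedge (k := j + 1) hj1 (by omega) (by omega) hte' hyb hya hab.symm pb pa.add_two_pi rb ra
        (Or.inr rfl) (Or.inl rfl) hm hup (by linarith)

/-- The `k`-th triangle of the cyclic order. [folklore] -/
def tri (k : ℕ) : Finset E3 := {y, E.nb k, E.nb (k + 1)}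

/-- Periodicity of `tri`. [folklore] -/
theorem tri_add_d (k : ℕ) : E.tri (k + E.d) = E.tri k := by
  unfold tri
  rw [E.periodic, show k + E.d + 1 = (k + 1) + E.d by ring, E.periodic]

/-- **Every fan triangle at `y` is a `tri k`.** [folklore] -/
theorem exists_tri_eq (hX1 : ∀ y ∈ X, ‖y‖ = 1) {t : Finset E3} (ht : t ∈ trisAt X y) :
    ∃ k, k < E.d ∧ t = E.tri k := by
  obtain ⟨a, b, ha, hb, hya, hyb, hab, hte⟩ := exists_eq_triple_of_mem_trisAt hX1 ht
  obtain ⟨i, hi, rfl⟩ := E.surj a ha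
  obtain ⟨j, hj, rfl⟩ := E.surj b hb
  have htF := (mem_trisAt.1 ht).1
  have hij : i ≠ j := fun h => hab (by rw [h])
  have hte' : t = {y, E.nb j, E.nb i} := by
    rw [hte]; ext z; simp only [Finset.mem_insert, Finset.mem_singleton]; tauto
  have hlast : E.nb (E.d - 1 + 1) = E.nb 0 := by
    rw [Nat.sub_add_cancel E.d_pos, show E.d = 0 + E.d by ring, E.periodic]
  rcases Nat.lt_or_gt_of_ne hij with hlt | hlt
  · rcases E.consec_aux hX1 hlt hj htF hte with rfl | ⟨rfl, hjd⟩
    · exact ⟨i, hi, hte⟩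
    · refine ⟨E.d - 1, by omega, ?_⟩
      unfold tri
      rw [hlast, show E.d - 1 = j by omega]
      exact hte'
  · rcases E.consec_aux hX1 hlt hi htF hte' with rfl | ⟨rfl, hid⟩
    · exact ⟨j, hj, hte'⟩
    · refine ⟨E.d - 1, by omega, ?_⟩
      unfold tri
      rw [hlast, show E.d - 1 = i by omega]
      exact hte

end NbrEnum

/-- **The link of a vertex is a single cycle** (closure form).  Let `X` be a finite set of
unit vectors of `ℝ³` with `0 ∈ interior (conv X)` and `y ∈ X`.  If a nonempty set `A` of fan
triangles at `y` contains, with any triangle, every fan triangle at `y` sharing a side with it,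
then `A` consists of ALL the fan triangles at `y`.
[cite: Hales2012, proof of Theorem 3 ("the hypermap of the fan is that of a triangulated sphere")] -/
theorem fanTriSets_link (hX1 : ∀ y ∈ X, ‖y‖ = 1) (h0 : (0 : E3) ∈ interior (convexHull ℝ (X : Set E3)))
    {A : Finset (Finset E3)} (hA : A ⊆ (fanTriSets X).filter (fun t => y ∈ t)) (hne : A.Nonempty)
    (hcl : ∀ t ∈ A, ∀ t' ∈ fanTriSets X, y ∈ t' → (t ∩ t').card = 2 → t' ∈ A) :
    A = (fanTriSets X).filter fun t => y ∈ t := by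
  classical
  change A ⊆ trisAt X y at hA
  change A = trisAt X y
  obtain ⟨t₀, ht₀A⟩ := hne
  have ht₀ : t₀ ∈ trisAt X y := hA ht₀A
  have hyX : y ∈ X := subset_of_mem_fanTriSets hX1 (mem_trisAt.1 ht₀).1 (mem_trisAt.1 ht₀).2
  have hy : ‖y‖ = 1 := hX1 y hyX
  -- the enumeration
  obtain ⟨a₀, -, ha₀, -⟩ := exists_eq_triple_of_mem_trisAt hX1 ht₀
  obtain ⟨E⟩ := nonempty_nbrEnum hX1 hy ⟨a₀, ha₀⟩
  -- the triangles at `y` are exactly the `tri k`, `k < d`, without repetition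
  have hsub : trisAt X y ⊆ (Finset.range E.d).image E.tri := by
    intro t ht
    obtain ⟨k, hk, rfl⟩ := E.exists_tri_eq hX1 ht
    exact Finset.mem_image_of_mem _ (Finset.mem_range.2 hk)
  have hcardT : (trisAt X y).card = E.d := by rw [card_trisAt_eq_card_fanNbrs hX1 h0, E.card_eq]
  have hle : ((Finset.range E.d).image E.tri).card ≤ E.d :=
    Finset.card_image_le.trans (Finset.card_range _).le
  have hcardI : ((Finset.range E.d).image E.tri).card = E.d :=
    le_antisymm hle (hcardT.symm.le.trans (Finset.card_le_card hsub))
  have heqT : trisAt X y = (Finset.range E.d).image E.tri :=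
    Finset.eq_of_subset_of_card_le hsub (by rw [hcardI, hcardT])
  have hinj : Set.InjOn E.tri (Finset.range E.d) :=
    Finset.card_image_iff.1 (by rw [hcardI, Finset.card_range])
  have htri_mem : ∀ k, E.tri k ∈ trisAt X y := by
    intro k
    have h := E.nb_mod k
    have : E.tri k = E.tri (k % E.d) := by
      conv_lhs => rw [← Nat.mod_add_div k E.d]
      induction k / E.d with
      | zero => simp
      | succ q ih => rw [Nat.mul_succ, ← add_assoc, E.tri_add_d, ih]
    rw [this, heqT]
    exact Finset.mem_image_of_mem _ (Finset.mem_range.2 (Nat.mod_lt _ E.d_pos))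
  -- `d ≥ 3`
  have hd3 : 3 ≤ E.d := by
    by_contra hlt
    have hd := E.d_pos
    rcases (show E.d = 1 ∨ E.d = 2 by omega) with h1 | h2
    · -- `tri 0 = {y, nb 0}` has fewer than three elements
      have hmem := htri_mem 0
      have h3 := card_eq_three_of_mem_fanTriSets hX1 (mem_trisAt.1 hmem).1
      have hper : E.nb 1 = E.nb 0 := by rw [show (1 : ℕ) = 0 + E.d by rw [h1], E.periodic]
      unfold NbrEnum.tri at h3
      rw [zero_add, hper] at h3
      have := Finset.card_le_two (a := y) (b := E.nb 0)
      rw [show ({y, E.nb 0, E.nb 0} : Finset E3) = {y, E.nb 0} by simp] at h3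
      omega
    · -- `tri 0 = tri 1`
      have hper : E.nb 2 = E.nb 0 := by rw [show (2 : ℕ) = 0 + E.d by rw [h2], E.periodic]
      have heq : E.tri 0 = E.tri 1 := by
        unfold NbrEnum.tri
        rw [zero_add, show (1 : ℕ) + 1 = 2 by rfl, hper]
        ext z; simp only [Finset.mem_insert, Finset.mem_singleton]; tauto
      have := hinj (Finset.mem_coe.2 (Finset.mem_range.2 (by omega)))
        (Finset.mem_coe.2 (Finset.mem_range.2 (by omega))) heq
      omega
  -- one step around the cycle
  have hstep : ∀ k, E.tri k ∈ A → E.tri (k + 1) ∈ A := by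
    intro k hk
    refine hcl _ hk _ (mem_trisAt.1 (htri_mem (k + 1))).1 (by unfold NbrEnum.tri; simp) ?_
    have hinter : E.tri k ∩ E.tri (k + 1) = {y, E.nb (k + 1)} := by
      have n02 := E.nb_ne_nb_add (k := k) (s := 2) two_pos (by omega)
      unfold NbrEnum.tri
      rw [show k + 1 + 1 = k + 2 by ring]
      ext z
      simp only [Finset.mem_inter, Finset.mem_insert, Finset.mem_singleton]
      constructor
      · rintro ⟨h1 | h1 | h1, h2⟩
        · exact Or.inl h1
        · rcases h2 with h2 | h2 | h2
          · exact Or.inl h2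
          · exact Or.inr h2
          · exact absurd (h1.symm.trans h2) n02
        · exact Or.inr h1
      · rintro (h | h)
        · exact ⟨Or.inl h, Or.inl h⟩
        · exact ⟨Or.inr (Or.inr h), Or.inr (Or.inl h)⟩
    rw [hinter, Finset.card_pair (E.nb_ne (k + 1)).symm]
  -- go around
  obtain ⟨k₀, hk₀, rfl⟩ := E.exists_tri_eq hX1 ht₀
  have hall : ∀ j, E.tri (k₀ + j) ∈ A := by
    intro j
    induction j with
    | zero => simpa using ht₀A
    | succ j ih => rw [← add_assoc]; exact hstep _ ih
  refine Finset.Subset.antisymm hA fun t ht => ?_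
  obtain ⟨k, hk, rfl⟩ := E.exists_tri_eq hX1 ht
  have h := hall (k + E.d - k₀)
  rwa [show k₀ + (k + E.d - k₀) = k + E.d by omega, E.tri_add_d] at h

end Link

end Literature.Geometry.DiscreteGeometry
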